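import Summits.PneNP.PneNP.Theorems.PstarTypedSALinearLevel
import Summits.PneNP.PneNP.Theorems.PstarSAHeadline

/-!
# T21.1 without simple overlaps: `SAFeasible (r/28)` from boundary expansion alone (the primed leaf)

FRONTIER range-avoidance ladder, rung F-N3 context (restricted-model lower bound for the Sherali–Adams hierarchy on typed
`P⋆`; cell `pnp-ideate`, ROUND-21 — nothing here bears on `P` vs `NP`).

The proof of `PstarTypedSALinearLevel.typedSALinearLevel` never uses `SimpleOverlap` (that hypothesis only enters the
SDP layer, BGMT Claim 3.4).  This file records the hypothesis-free core `saFeasible_of_boundaryExpanding` (the same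
assembly: `PstarSAAssembly.saFeasible_of_closure` with the closure of `PstarSAClosure.exists_closure` and the laws
`PstarSAPeeling.law`, `law_consistent`, `law_total`, `law_support`) and derives the primed headline supplier
`typedSALinearLevel' : PstarSAHeadline.TypedSALinearLevel'`, so that `PstarSAHeadline.saLinearBlind_of'` needs only the
existence of boundary-expanding typed instances (`ExpandingTypedExist'`).
-/

set_option linter.dupNamespace false

open Finset Literature.Computability.Complexity
open Summit.PneNP.PneNP.Theorems.PstarSALevel (varSet cyl bdry BoundaryExpanding SAFeasible)
open Summit.PneNP.PneNP.Theorems.PstarSAPeeling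
open Summit.PneNP.PneNP.Theorems.PstarSAClosure (exists_closure)
open Summit.PneNP.PneNP.Theorems.PstarSAAssembly (saFeasible_of_closure)

namespace Summit.PneNP.PneNP.Theorems.PstarTypedSALinearLevel

variable {n m : ℕ}

/-- **Linear-level Sherali–Adams feasibility from boundary expansion alone.**  On a typed pure-`P⋆` instance that is
`(r, 3/2)`-boundary expanding, the fibre of every target is Sherali–Adams feasible at level `r / 28`. -/
theorem saFeasible_of_boundaryExpanding {r : ℕ} {I : LocalMap 4 n m} (hI : I.IsPure xorAndPred)
    (hT : PstarTyped.Typed I) (hB : BoundaryExpanding r I) (y : Fin m → Bool) : SAFeasible (r / 28) I y := by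
  classical
  set t : ℕ := r / 28 with ht
  choose cl hsub hcard hclosed using fun S : Finset (Fin n) => exists_closure I r hB S
  let Closed : Finset (Fin n) → Prop := fun S₁ => ∀ M : Finset (Fin m), M.Nonempty → (∀ j ∈ M, ¬ varSet I j ⊆ S₁) →
    M.card + 4 * t ≤ r → 5 * M.card ≤ 4 * (bdry I M \ S₁).card
  refine saFeasible_of_closure I y t (34 * t) Closed cl (law I y) hsub ?_ ?_ (fun S x => law_nonneg I y S x) ?_
    (fun S j x hj hx => law_support hI y hj hx) ?_
  · intro S hS M hM hnd hbud
    exact hclosed S M hM hnd (by omega)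
  · intro S hS
    have := hcard S
    omega
  · intro S' hS'
    rcases Nat.eq_zero_or_pos r with hr0 | hr
    · have hS0 : S' = ∅ := card_eq_zero.1 (by omega)
      subst hS0
      refine law_total hI hT y ?_
      rw [dom_empty]
      exact strictExpandingOff_empty I ∅
    · have hlt : 2 * S'.card < 3 * r := by omega
      exact law_total_of_boundaryExpanding hI hT hB y (card_dom_le hB hlt).1
  · intro S₁ S₂ hC h12 hS₂ a
    refine law_consistent hI hT y h12 ?_ a
    rcases Nat.eq_zero_or_pos r with hr0 | hr
    · have hS0 : S₂ = ∅ := card_eq_zero.1 (by omega)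
      subst hS0
      rw [dom_empty, empty_sdiff]
      exact strictExpandingOff_empty I S₁
    · intro J hJ hne
      have hlt : 2 * S₂.card < 3 * r := by omega
      obtain ⟨-, hdom3⟩ := card_dom_le hB hlt
      have hJc : J.card ≤ (dom I S₂).card := card_le_card (hJ.trans sdiff_subset)
      have hnd : ∀ j ∈ J, ¬ varSet I j ⊆ S₁ := fun j hj h => (mem_sdiff.1 (hJ hj)).2 (mem_dom.2 h)
      have h5 := hC J hne hnd (by omega)
      have hpos := hne.card_pos
      omega

/-- **T21.1′ supplier (primed headline)**: `PstarSAHeadline.TypedSALinearLevel'` — linear-level Sherali–Adams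
feasibility for boundary-expanding typed pure-`P⋆`, no simple-overlap hypothesis, `c = 28`. -/
theorem typedSALinearLevel' : PstarSAHeadline.TypedSALinearLevel' :=
  ⟨28, by norm_num, fun _ _ _ _ hI hT hB y => saFeasible_of_boundaryExpanding hI hT hB y⟩

end Summit.PneNP.PneNP.Theorems.PstarTypedSALinearLevel
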